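import Summits.Ventures.YMGap.RobustBall.HeatBathPoincareZdDLR
import Summits.Ventures.YMGap.RobustBall.LangevinPoincareZd
import Summits.Ventures.YMGap.Thresholds.ZdSmoothingLipschitz
import HarnessLib

/-!
# Robust ball (Y2) — THE LANGEVIN (GRADIENT-FORM) POINCARÉ INEQUALITY OF EVERY INFINITE-VOLUME GIBBS STATE of strong-coupling `SU(N)`
# lattice Yang–Mills on `ℤ^d`, on the Kantorovich–Rubinstein window

HONEST FRAMING: venture file of the cell `pub-ymgap` (QuantumFields programme), track ROBUST-BALL, seat rb-p2 (g14); the DLR-STATE companion of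
`LangevinPoincare.lean` (tori, uniformly in the volume), `LangevinPoincareZd.lean` (finite volumes of `ℤ^d` with boundary condition, uniformly in both)
and `LangevinPoincareLimit.lean` (tight infinite-volume limits of the torus states).  LATTICE statements at STRONG COUPLING for the DLR states
`μ ∈ 𝒢(γ)` of the Wilson specification `γ = ymSpecification χ_N (Nβ)` of `SU(N)` lattice Yang–Mills on `ℤ^d` ('t Hooft coupling `β`); Wilson action only
(class K); nothing about `β → ∞`, the continuum or Clay.

THE STATEMENT (★★★ `gibbs_variance_le_integral_Gam_of_oneLinkKRModulus`): `d ≥ 1`, `2(d−1)|β| ≤ R`, `OneLinkKRModulus N R K`, `c := 6(d−1)|β|K < 1`,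
`K₀ := N/2 − N|β|·2(d−1) > 0`.  Then for EVERY DLR state `μ ∈ 𝒢(γ)`, every finite link set `Δ` and every smooth `f` of the link matrices over `Δ`,
`Var_μ(F) ≤ ((1 − c)K₀)⁻¹ ∫ Γ(f,f)((U_e)_{e∈Δ}) μ(dU)`,  `F = f((U_e)_{e∈Δ})` (`matrixCylinder Δ f`), `Γ = LatticeBakryEmery.Gam` (Shen–Zhu–Zhu's (3.7)):
the Langevin dynamics of the infinite-volume theory, in ANY of its Gibbs states, has a spectral gap `≥ (1 − c)K₀` on smooth local observables (standard
reading of the Poincaré inequality).  This is the shape of Shen–Zhu–Zhu's Remark 1.3 / Cor. 4.5 (4.13) («for the infinite-volume measure») and of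
Stroock–Zegarlinski's Gibbs-state Poincaré inequality, for EVERY DLR state and with no uniqueness input.  ★★★ `su2_gibbs_variance_le_integral_Gam`:
`SU(2)`, `d = 4`, HYPOTHESIS-FREE on `0 ≤ β_W < 2/9` (tree coupling `β_W/2`): `Var_μ(F) ≤ ((1 − 9β_W/2)(1 − 3β_W))⁻¹ ∫ Γ(f,f) dμ` for every DLR state `μ`
— the Bakry–Émery windows for this inequality are `β_W < 1/12` (SZZ) and `β_W < 1/8` (venture); ★★ `su2_gibbs_variance_le_integral_Gam_dim3`: `d = 3`,
`0 ≤ β_W < 1/3`, constant `((1 − 3β_W)(1 − 2β_W))⁻¹`.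
MECHANISM: g12's heat-bath Poincaré inequality of every DLR state (`HeatBathPoincareZd.gibbsVariance_le_of_oneLinkKRModulus`, Lipschitz cylinders) ∘ the
fibre identity `∫ (F(U) − F(σ))² γ_{x}(dσ|U) = (F − T_x F)²(U) + Var_{siteLaw}(F(U[x ↦ ·]))` ∘ the one-link Bakry–Émery step `LangevinPoincare.section_variance_le`
in 't Hooft form (`siteLaw_ymSpecification_thooft`, `‖B_U‖_op ≤ 2(d−1)|β|`) ∘ the DLR equations `μ γ_{x} = μ` (`IsGibbsMeasure.setIntegral_integral_spec`)
to integrate the bias and the block back against `μ`; plus `exists_isLipschitzCylinder_matrixCylinder` (a smooth function of the link matrices is a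
Lipschitz cylinder observable: mean-value inequality on a ball containing `SU(N)^Δ`, McShane extension).  0 sorry, 0 definitions.
References: H. Shen, R. Zhu, X. Zhu, CMP 400 (2023) 805–851, Rem. 1.3, Cor. 4.5 (4.13); D. W. Stroock, B. Zegarlinski, CMP 144 (1992) 303–323;
H.-O. Georgii, Gibbs Measures and Phase Transitions (2011), Rem. 1.24.  Everything here is proved. [folklore]
-/

noncomputable section

open scoped Matrix ComplexConjugate BigOperators Matrix.Norms.Frobenius ContDiff Topology ProbabilityTheory NNReal
open Matrix Complex Finset MeasureTheory Filter ProbabilityTheory Function Real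
open Literature.Probability.LatticeModels Literature.Probability.LatticeModels.DobrushinMetric
open Literature.MathematicalPhysics.QuantumLattice hiding torusNorm
open Literature.MathematicalPhysics.QuantumFieldTheory hiding ZdEdge
open Summit.QuantumFields.YangMills.Theorems.StrongPinningPoincare
open Literature.MathematicalPhysics.QuantumFieldTheory.SUNBakryEmery (SUN FrameIdx frame haarSU pot)
open Literature.MathematicalPhysics.QuantumFieldTheory.Balaban1983to89.StrongCouplingDobrushinWindow (OneLinkKRModulus)
open Summit.Ventures.YMGap.LatticeBakryEmery
open Summit.Ventures.YMGap.RobustBall.HeatBathPoincareZd (gibbsVariance_le_of_oneLinkKRModulus)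

namespace Summit.Ventures.YMGap.RobustBall.LangevinPoincare

variable {d N : ℕ}

/-! ### A smooth function of the link matrices is a Lipschitz cylinder observable -/

section Lipschitz

/-- **A smooth function of finitely many link matrices is a Lipschitz cylinder observable** (for SOME constant): `f` is `C¹` on the
(finite-dimensional) matrix space, hence Lipschitz on a closed ball containing the compact set `SU(N)^Δ` (mean-value inequality), and the Pi–Frobenius
distance there is at most `N` times the entry (sup) distance; McShane packaging (`ZdSmoothing.isLipschitzCylinder_of_dist_le`). [folklore] -/
theorem exists_isLipschitzCylinder_matrixCylinder (Δ : Finset (ZdEdge d)) {f : Cfg ↥Δ N → ℝ} (hf : ContDiff ℝ 1 f) :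
    ∃ K : ℝ≥0, IsLipschitzCylinder (fundamentalRep (Fin N)) (matrixCylinder Δ f) Δ K := by
  classical
  -- the configuration map `U ↦ (U_e)_{e ∈ Δ}` and its compact image, on which the `C¹` function `f` is Lipschitz
  set cfg : LGConfig d (SUN N) → Cfg ↥Δ N := fun U e => (U e : Matrix (Fin N) (Fin N) ℂ) with hcfg
  have hcfgc : Continuous cfg := continuous_pi fun e => continuous_subtype_val.comp (continuous_apply _)
  obtain ⟨C, hlip⟩ := (hf.locallyLipschitz.locallyLipschitzOn (s := Set.range cfg)).exists_lipschitzOnWith_of_compact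
    (isCompact_range hcfgc)
  -- the entry distance dominates the Pi–Frobenius distance up to the factor `N`
  have hdist : ∀ U V : LGConfig d (SUN N), dist (cfg U) (cfg V) ≤
      (N : ℝ) * dist (fun e : ↥Δ => suEntries (U e)) (fun e : ↥Δ => suEntries (V e)) := by
    intro U V
    refine (dist_pi_le_iff (by positivity)).2 fun e => ?_
    rw [dist_eq_norm]
    show ‖((U e : SUN N) : Matrix (Fin N) (Fin N) ℂ) - ((V e : SUN N) : Matrix (Fin N) (Fin N) ℂ)‖ ≤ _
    rw [← frobNorm_eq_norm]
    refine (ZdSmoothing.suFrobDist_le_mul_dist_suEntries (U e) (V e)).trans ?_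
    exact mul_le_mul_of_nonneg_left (dist_le_pi_dist (fun e : ↥Δ => suEntries (U e)) (fun e : ↥Δ => suEntries (V e)) e) (Nat.cast_nonneg _)
  refine ⟨C * ⟨(N : ℝ), Nat.cast_nonneg _⟩, ZdSmoothing.isLipschitzCylinder_of_dist_le fun U V => ?_⟩
  have h1 := hlip.dist_le_mul _ (Set.mem_range_self U) _ (Set.mem_range_self V)
  rw [Real.dist_eq] at h1
  show |f (cfg U) - f (cfg V)| ≤ _
  refine h1.trans ?_
  push_cast
  rw [mul_assoc]
  exact mul_le_mul_of_nonneg_left (hdist U V) C.2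

end Lipschitz

/-! ### The Langevin Poincaré inequality of every DLR state -/

section Gibbs

/-- ★★★ **THE LANGEVIN (GRADIENT-FORM) POINCARÉ INEQUALITY OF EVERY INFINITE-VOLUME GIBBS STATE** (`SU(N)` lattice Yang–Mills on `ℤ^d`, 't Hooft
coupling `β`, bare `Nβ`): if `2(d−1)|β| ≤ R`, `OneLinkKRModulus N R K` (`K ≥ 0`), `6(d−1)|β|K ≤ c < 1` and `K₀ := N/2 − N|β|·2(d−1) > 0`, then EVERY DLR state
`μ` of the Wilson specification, every finite link set `Δ` and every smooth `f` of the link matrices over `Δ` satisfy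
`Var_μ(f((U_e)_{e∈Δ})) ≤ ((1 − c)K₀)⁻¹ ∫ Γ(f,f)((U_e)_{e∈Δ}) μ(dU)` — the Langevin dynamics of the infinite-volume theory has spectral gap `≥ (1 − c)K₀` in
every Gibbs state (standard reading); no uniqueness input. [folklore] -/
theorem gibbs_variance_le_integral_Gam_of_oneLinkKRModulus (hd : 1 ≤ d) (hN : 1 ≤ N) {β R K c : ℝ} (hK : 0 ≤ K)
    (hR : |β| * (2 * ((d : ℝ) - 1)) ≤ R) (hmod : OneLinkKRModulus N R K) (hc : 6 * ((d : ℝ) - 1) * |β| * K ≤ c) (hc1 : c < 1)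
    (hK₀ : 0 < (N : ℝ) / 2 - N * |β| * (2 * ((d : ℝ) - 1)))
    {μ : Measure (LGConfig d (SUN N))} (hμ : μ ∈ ymGibbsMeasures (d := d) (fundamentalRep (Fin N)) ((N : ℝ) * β))
    (Δ : Finset (ZdEdge d)) {f : Cfg ↥Δ N → ℝ} (hf : ContDiff ℝ ∞ f) :
    Var[matrixCylinder Δ f; μ] ≤
      ((1 - c) * ((N : ℝ) / 2 - N * |β| * (2 * ((d : ℝ) - 1))))⁻¹ *
        ∫ U, Gam f f (fun e : ↥Δ => (U e : Matrix (Fin N) (Fin N) ℂ)) ∂μ := by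
  classical
  haveI : SecondCountableTopology (Matrix (Fin N) (Fin N) ℂ) := inferInstanceAs (SecondCountableTopology (Fin N → Fin N → ℂ))
  haveI : SecondCountableTopology (SUN N) := Topology.IsEmbedding.subtypeVal.secondCountableTopology
  have hN0 : N ≠ 0 := by omega
  have hNpos : (0 : ℝ) < N := by exact_mod_cast Nat.pos_of_ne_zero hN0
  have hρc := continuous_fundamentalRep (Fin N)
  set K₀ : ℝ := (N : ℝ) / 2 - N * |β| * (2 * ((d : ℝ) - 1)) with hK₀def
  set γ := ymSpecification (d := d) (fundamentalRep (Fin N)) ((N : ℝ) * β) with hγdef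
  have hγ : IsSpecification γ := isSpecification_ymSpecification_of_t2Space _ hρc _
  have hμ' : IsGibbsMeasure γ μ := hμ
  haveI := hμ'.isProbabilityMeasure
  have hc0 : 0 < 1 - c := by linarith
  -- the observable (a Lipschitz cylinder) and the link blocks of `Γ`
  set cfgV : LGConfig d (SUN N) → Cfg ↥Δ N := fun U e => (U e : Matrix (Fin N) (Fin N) ℂ) with hcfgV
  have hcfgc : Continuous cfgV := continuous_pi fun e => continuous_subtype_val.comp (continuous_apply _)
  set F : LGConfig d (SUN N) → ℝ := matrixCylinder Δ f with hFdef
  have hFeq : ∀ U, F U = f (cfgV U) := fun U => rfl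
  have hFc : Continuous F := hf.continuous.comp hcfgc
  have hFm : Measurable F := hFc.measurable
  obtain ⟨M, hM⟩ := exists_bound_of_continuous hFc
  obtain ⟨KF, hFL⟩ := exists_isLipschitzCylinder_matrixCylinder (N := N) Δ (hf.of_le (by norm_cast))
  set blk : ZdEdge d → LGConfig d (SUN N) → ℝ := fun x U =>
    if hx : x ∈ Δ then ∑ α : FrameIdx N, algD (lk (⟨x, hx⟩ : ↥Δ) (frame α)) f (cfgV U) ^ 2 else 0 with hblk
  have hblk_of_mem : ∀ {x} (hx : x ∈ Δ) (U : LGConfig d (SUN N)), blk x U = ∑ α : FrameIdx N, algD (lk (⟨x, hx⟩ : ↥Δ) (frame α)) f (cfgV U) ^ 2 :=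
    fun hx U => by simp only [hblk, dif_pos hx]
  have hblkc : ∀ {x} (hx : x ∈ Δ), Continuous (blk x) := fun {x} hx => by
    have h : blk x = fun U => ∑ α : FrameIdx N, algD (lk (⟨x, hx⟩ : ↥Δ) (frame α)) f (cfgV U) ^ 2 := funext (hblk_of_mem hx)
    rw [h]
    exact continuous_finsetSum _ fun α _ => ((contDiff_algD hf _).continuous.comp hcfgc).pow 2
  -- (1) the heat-bath Poincaré inequality of the DLR state (rb-p2 g12)
  have hHB := gibbsVariance_le_of_oneLinkKRModulus hd hN hK hR hmod hc hc1 hμ hFL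
  -- (2)+(3) PER LINK of the support: fibre identity, one-link Bakry–Émery, DLR equations
  have key : ∀ x ∈ Δ, ∫ U, ∫ σ, (F U - F σ) ^ 2 ∂(γ {x} U) ∂μ ≤ 2 * K₀⁻¹ * ∫ U, blk x U ∂μ := by
    intro x hx
    have hlaw : ∀ U, IsProbabilityMeasure (siteLaw γ x U) := fun U => isProbabilityMeasure_siteLaw hγ x U
    set m : LGConfig d (SUN N) → ℝ := siteAvg γ x F with hmdef
    have hmm : Measurable m := measurable_siteAvg hγ x hFm
    have hmb : ∀ U, |m U| ≤ M := fun U => abs_siteAvg_le hγ x hM U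
    have hm_eq : ∀ U, m U = ∫ s, F (update U x s) ∂(siteLaw γ x U) := fun U => siteAvg_eq_integral_siteLaw hγ x hFm U
    have hm_upd : ∀ U s, m (update U x s) = m U := fun U s => by
      rw [hm_eq, hm_eq, siteLaw_congr_of_eq_off' hγ x (fun z hz => update_of_ne hz _ _)]
      simp only [update_idem]
    have hh : Measurable fun U => (F U - m U) ^ 2 := (hFm.sub hmm).pow_const 2
    have hhb : ∀ U, |(F U - m U) ^ 2| ≤ (2 * M) ^ 2 := fun U => by
      rw [abs_pow]
      refine pow_le_pow_left₀ (abs_nonneg _) ((abs_sub _ _).trans ?_) 2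
      linarith [hM U, hmb U]
    obtain ⟨Mb, hMb⟩ := exists_bound_of_continuous (hblkc hx)
    -- pointwise in `U`: inner integral = bias² + conditional variance, conditional variance ≤ K₀⁻¹ · block average
    have hpt : ∀ U, ∫ σ, (F U - F σ) ^ 2 ∂(γ {x} U) ≤ (F U - m U) ^ 2 + K₀⁻¹ * siteAvg γ x (blk x) U := by
      intro U
      haveI := hlaw U
      have e1 : ∫ σ, (F U - F σ) ^ 2 ∂(γ {x} U) = ∫ s, (F U - F (update U x s)) ^ 2 ∂(siteLaw γ x U) :=
        siteAvg_eq_integral_siteLaw hγ x (f := fun σ => (F U - F σ) ^ 2) ((measurable_const.sub hFm).pow_const 2) U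
      have hψm : Measurable fun s : SUN N => F (update U x s) := hFm.comp (measurable_update U)
      rw [e1, integral_sq_sub_eq_sq_add_variance (siteLaw γ x U) hψm (fun s => hM _) (F U), ← hm_eq U]
      refine add_le_add le_rfl ?_
      rw [siteAvg_eq_integral_siteLaw hγ x (hblkc hx).measurable U]
      simp_rw [hblk_of_mem hx, hFeq]
      simp_rw [show ∀ s : SUN N, cfgV (update U x s) = update (cfgV U) ⟨x, hx⟩ (s : Matrix (Fin N) (Fin N) ℂ) from
        fun s => restrict_update_eq Δ hx U s]
      rw [hm_eq U]
      simp_rw [hFeq, show ∀ s : SUN N, cfgV (update U x s) = update (cfgV U) ⟨x, hx⟩ (s : Matrix (Fin N) (Fin N) ℂ) from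
        fun s => restrict_update_eq Δ hx U s]
      rw [hγdef, siteLaw_ymSpecification_thooft β x U]
      set B := stapleField β x U with hBdef
      have hB : matrixOpNorm B ≤ |β| * (2 * ((d : ℝ) - 1)) := matrixOpNorm_stapleField_le hd hN β x U
      have hK1 : K₀ ≤ (N : ℝ) / 2 - N * matrixOpNorm B := by
        have : (N : ℝ) * matrixOpNorm B ≤ N * (|β| * (2 * ((d : ℝ) - 1))) := mul_le_mul_of_nonneg_left hB hNpos.le
        rw [hK₀def]; linarith
      have hK1pos : 0 < (N : ℝ) / 2 - N * matrixOpNorm B := lt_of_lt_of_le hK₀ hK1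
      have hsec := section_variance_le hN0 hf (cfgV U) ⟨x, hx⟩ B hK1pos
      set ν : Measure (SUN N) := (haarSU N).tilted fun g : SUN N => (N : ℝ) * ((g : Matrix (Fin N) (Fin N) ℂ) * B).trace.re with hν
      have hwc : Continuous fun g : SUN N => Real.exp (pot (N : ℝ) B g) :=
        Real.continuous_exp.comp (SUNBakryEmery.continuous_restrict (SUNBakryEmery.contDiff_pot _ B))
      haveI : IsProbabilityMeasure ν := isProbabilityMeasure_tilted (SUNBakryEmery.integrable_of_continuous_SUN hwc _)
      have hψc : Continuous fun g : SUN N => f (update (cfgV U) ⟨x, hx⟩ (g : Matrix (Fin N) (Fin N) ℂ)) :=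
        SUNBakryEmery.continuous_restrict (contDiff_section hf (cfgV U) ⟨x, hx⟩)
      have hvar : Var[fun g : SUN N => f (update (cfgV U) ⟨x, hx⟩ (g : Matrix (Fin N) (Fin N) ℂ)); ν] = ∫ g, (f (update (cfgV U) ⟨x, hx⟩
          (g : Matrix (Fin N) (Fin N) ℂ)) - ∫ g', f (update (cfgV U) ⟨x, hx⟩ (g' : Matrix (Fin N) (Fin N) ℂ)) ∂ν) ^ 2 ∂ν :=
        variance_eq_integral hψc.measurable.aemeasurable
      show ∫ g, (f (update (cfgV U) ⟨x, hx⟩ (g : Matrix (Fin N) (Fin N) ℂ)) - ∫ g', f (update (cfgV U) ⟨x, hx⟩ (g' : Matrix (Fin N) (Fin N) ℂ)) ∂ν) ^ 2 ∂ν ≤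
        K₀⁻¹ * ∫ g, ∑ α : FrameIdx N, algD (lk (⟨x, hx⟩ : ↥Δ) (frame α)) f (update (cfgV U) ⟨x, hx⟩ (g : Matrix (Fin N) (Fin N) ℂ)) ^ 2 ∂ν
      rw [← hvar, ← div_eq_inv_mul, le_div_iff₀ hK₀]
      calc Var[fun g : SUN N => f (update (cfgV U) ⟨x, hx⟩ (g : Matrix (Fin N) (Fin N) ℂ)); ν] * K₀
          ≤ Var[fun g : SUN N => f (update (cfgV U) ⟨x, hx⟩ (g : Matrix (Fin N) (Fin N) ℂ)); ν] * ((N : ℝ) / 2 - N * matrixOpNorm B) :=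
            mul_le_mul_of_nonneg_left hK1 (variance_nonneg _ _)
        _ ≤ _ := by rw [mul_comm]; exact hsec
    -- integrate against the DLR state; the DLR equations `μ γ_{x} = μ` twice
    have hI0 : Integrable (fun U => ∫ σ, (F U - F σ) ^ 2 ∂(γ {x} U)) μ :=
      HeatBath.integrable_of_abs_le (HeatBathPoincareZd.measurable_integral_sq_sub hγ x hFm hM)
        (fun U => HeatBathPoincareZd.abs_integral_sq_sub_le hγ x hM U)
    have hI1 : Integrable (fun U => (F U - m U) ^ 2) μ := HeatBath.integrable_of_abs_le hh hhb
    have hI2 : Integrable (fun U => K₀⁻¹ * siteAvg γ x (blk x) U) μ :=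
      (HeatBath.integrable_of_abs_le (measurable_siteAvg hγ x (hblkc hx).measurable) (fun U => abs_siteAvg_le hγ x hMb U)).const_mul _
    have hDLR1 : ∫ U, (F U - m U) ^ 2 ∂μ = ∫ U, siteAvg γ x (fun U' => (F U' - m U') ^ 2) U ∂μ := by
      have e := hμ'.setIntegral_integral_spec hγ {x} (B := Set.univ) MeasurableSet.univ hh hhb
      simp only [Measure.restrict_univ] at e
      exact e.symm
    have hDLR1' : ∀ U, siteAvg γ x (fun U' => (F U' - m U') ^ 2) U ≤ K₀⁻¹ * siteAvg γ x (blk x) U := by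
      intro U
      haveI := hlaw U
      have e1 : siteAvg γ x (fun U' => (F U' - m U') ^ 2) U = ∫ s, (F (update U x s) - m U) ^ 2 ∂(siteLaw γ x U) := by
        rw [siteAvg_eq_integral_siteLaw hγ x hh U]
        simp only [hm_upd]
      have hψm : Measurable fun s : SUN N => F (update U x s) := hFm.comp (measurable_update U)
      have e2 : ∫ s, (F (update U x s) - m U) ^ 2 ∂(siteLaw γ x U) =
          ∫ σ, (F U - F σ) ^ 2 ∂(γ {x} U) - (F U - m U) ^ 2 := by
        have e4 : ∫ σ, (F U - F σ) ^ 2 ∂(γ {x} U) = ∫ s, (F U - F (update U x s)) ^ 2 ∂(siteLaw γ x U) :=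
          siteAvg_eq_integral_siteLaw hγ x (f := fun σ => (F U - F σ) ^ 2) ((measurable_const.sub hFm).pow_const 2) U
        rw [e4, integral_sq_sub_eq_sq_add_variance (siteLaw γ x U) hψm (fun s => hM _) (F U), ← hm_eq U]
        ring
      rw [e1, e2]
      linarith [hpt U]
    have hDLR2 : ∫ U, siteAvg γ x (blk x) U ∂μ = ∫ U, blk x U ∂μ := by
      have e := hμ'.setIntegral_integral_spec hγ {x} (B := Set.univ) MeasurableSet.univ (hblkc hx).measurable hMb
      simp only [Measure.restrict_univ] at e
      exact e
    have hstep1 : ∫ U, ∫ σ, (F U - F σ) ^ 2 ∂(γ {x} U) ∂μ ≤ ∫ U, (F U - m U) ^ 2 ∂μ + ∫ U, K₀⁻¹ * siteAvg γ x (blk x) U ∂μ := by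
      rw [← integral_add hI1 hI2]
      exact integral_mono hI0 (hI1.add hI2) hpt
    have hstep2 : ∫ U, (F U - m U) ^ 2 ∂μ ≤ ∫ U, K₀⁻¹ * siteAvg γ x (blk x) U ∂μ := by
      rw [hDLR1]
      exact integral_mono (HeatBath.integrable_of_abs_le (measurable_siteAvg hγ x hh) (fun U => abs_siteAvg_le hγ x hhb U)) hI2 hDLR1'
    rw [integral_const_mul, hDLR2] at hstep1 hstep2
    linarith
  -- SUM OVER THE SUPPORT
  have hsum : ∑ x ∈ Δ, ∫ U, ∫ σ, (F U - F σ) ^ 2 ∂(γ {x} U) ∂μ ≤ 2 * K₀⁻¹ * ∫ U, Gam f f (cfgV U) ∂μ := by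
    calc _ ≤ ∑ x ∈ Δ, 2 * K₀⁻¹ * ∫ U, blk x U ∂μ := Finset.sum_le_sum key
      _ = 2 * K₀⁻¹ * ∫ U, Gam f f (cfgV U) ∂μ := by
          rw [← Finset.mul_sum, ← integral_finsetSum _ fun x hx =>
            HeatBath.integrable_of_abs_le (hblkc hx).measurable (Classical.choose_spec (exists_bound_of_continuous (hblkc hx)))]
          congr 1
          refine integral_congr_ae (ae_of_all _ fun U => ?_)
          show ∑ i ∈ Δ, blk i U = Gam f f (cfgV U)
          rw [Gam_eq_sum_blocks, ← Finset.sum_attach]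
          exact Finset.sum_congr rfl fun i _ => hblk_of_mem i.2 U
  -- ASSEMBLY
  calc Var[F; μ] ≤ (2 * (1 - c))⁻¹ * ∑ x ∈ Δ, ∫ U, ∫ σ, (F U - F σ) ^ 2 ∂(γ {x} U) ∂μ := hHB
    _ ≤ (2 * (1 - c))⁻¹ * (2 * K₀⁻¹ * ∫ U, Gam f f (cfgV U) ∂μ) := mul_le_mul_of_nonneg_left hsum (by positivity)
    _ = ((1 - c) * K₀)⁻¹ * ∫ U, Gam f f (cfgV U) ∂μ := by field_simp

/-- ★★★ **`SU(2)`, `d = 4`, HYPOTHESIS-FREE on `0 ≤ β_W < 2/9`** (tree coupling `β_W/2`, quarter modulus): for EVERY DLR state `μ` of 4D `SU(2)` lattice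
Yang–Mills, every finite link set `Δ` and every smooth `f` of the link matrices over `Δ`,
`Var_μ(f((U_e)_{e∈Δ})) ≤ ((1 − 9β_W/2)(1 − 3β_W))⁻¹ ∫ Γ(f,f) dμ` — the infinite-volume Langevin dynamics has spectral gap `≥ (1 − 9β_W/2)(1 − 3β_W)` in every
Gibbs state (the DLR state is unique on this window, `StarUniquenessZd`, but uniqueness is not used); the Bakry–Émery windows for this inequality are `β_W < 1/12`
(Shen–Zhu–Zhu) and `β_W < 1/8` (venture, constant `(1 − 8β_W)⁻¹`). [folklore] -/
theorem su2_gibbs_variance_le_integral_Gam {βW : ℝ} (h0 : 0 ≤ βW) (h : βW < 2 / 9)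
    {μ : Measure (LGConfig 4 (SUN 2))} (hμ : μ ∈ ymGibbsMeasures (d := 4) (fundamentalRep (Fin 2)) (βW / 2))
    (Δ : Finset (ZdEdge 4)) {f : Cfg ↥Δ 2 → ℝ} (hf : ContDiff ℝ ∞ f) :
    Var[matrixCylinder Δ f; μ] ≤ ((1 - 9 * βW / 2) * (1 - 3 * βW))⁻¹ * ∫ U, Gam f f (fun e : ↥Δ => (U e : Matrix (Fin 2) (Fin 2) ℂ)) ∂μ := by
  have hβ : ((2 : ℕ) : ℝ) * (βW / 4) = βW / 2 := by push_cast; ring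
  have habs : |βW / 4| = βW / 4 := abs_of_nonneg (by positivity)
  have hμ4 : μ ∈ ymGibbsMeasures (d := 4) (fundamentalRep (Fin 2)) (((2 : ℕ) : ℝ) * (βW / 4)) := by rwa [hβ]
  have key := gibbs_variance_le_integral_Gam_of_oneLinkKRModulus (d := 4) (N := 2) (by norm_num) (by norm_num) (β := βW / 4) zero_le_one
    (R := 3 * βW / 2) (by rw [habs]; norm_num; linarith) (SlabAreaLawDimensions.su2_oneLinkKRModulus_of_le_one (by linarith))
    (c := 9 * βW / 2) (by rw [habs]; norm_num; linarith) (by linarith) (by rw [habs]; norm_num; linarith) hμ4 Δ hf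
  have e : (1 - 9 * βW / 2) * (((2 : ℕ) : ℝ) / 2 - (2 : ℕ) * |βW / 4| * (2 * (((4 : ℕ) : ℝ) - 1))) = (1 - 9 * βW / 2) * (1 - 3 * βW) := by
    rw [habs]; push_cast; ring
  rw [e] at key
  exact key

/-- ★★ **`SU(2)`, `d = 3`, HYPOTHESIS-FREE on `0 ≤ β_W < 1/3`** (tree coupling `β_W/2`, quarter modulus, `c = 3β_W`, `K₀ = 1 − 2β_W`): for EVERY DLR state
`μ` of 3D `SU(2)` lattice Yang–Mills and every smooth `f` of the link matrices over a finite `Δ`, `Var_μ(f((U_e)_{e∈Δ})) ≤ ((1 − 3β_W)(1 − 2β_W))⁻¹ ∫ Γ(f,f) dμ`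
(the Bakry–Émery window for this inequality in `d = 3` is `β_W < 1/6`). [folklore] -/
theorem su2_gibbs_variance_le_integral_Gam_dim3 {βW : ℝ} (h0 : 0 ≤ βW) (h : βW < 1 / 3)
    {μ : Measure (LGConfig 3 (SUN 2))} (hμ : μ ∈ ymGibbsMeasures (d := 3) (fundamentalRep (Fin 2)) (βW / 2))
    (Δ : Finset (ZdEdge 3)) {f : Cfg ↥Δ 2 → ℝ} (hf : ContDiff ℝ ∞ f) :
    Var[matrixCylinder Δ f; μ] ≤ ((1 - 3 * βW) * (1 - 2 * βW))⁻¹ * ∫ U, Gam f f (fun e : ↥Δ => (U e : Matrix (Fin 2) (Fin 2) ℂ)) ∂μ := by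
  have hβ : ((2 : ℕ) : ℝ) * (βW / 4) = βW / 2 := by push_cast; ring
  have habs : |βW / 4| = βW / 4 := abs_of_nonneg (by positivity)
  have hμ4 : μ ∈ ymGibbsMeasures (d := 3) (fundamentalRep (Fin 2)) (((2 : ℕ) : ℝ) * (βW / 4)) := by rwa [hβ]
  have key := gibbs_variance_le_integral_Gam_of_oneLinkKRModulus (d := 3) (N := 2) (by norm_num) (by norm_num) (β := βW / 4) zero_le_one
    (R := βW) (by rw [habs]; norm_num) (SlabAreaLawDimensions.su2_oneLinkKRModulus_of_le_one (by linarith))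
    (c := 3 * βW) (by rw [habs]; norm_num; linarith) (by linarith) (by rw [habs]; norm_num; linarith) hμ4 Δ hf
  have e : (1 - 3 * βW) * (((2 : ℕ) : ℝ) / 2 - (2 : ℕ) * |βW / 4| * (2 * (((3 : ℕ) : ℝ) - 1))) = (1 - 3 * βW) * (1 - 2 * βW) := by
    rw [habs]; push_cast; ring
  rw [e] at key
  exact key

end Gibbs

end Summit.Ventures.YMGap.RobustBall.LangevinPoincare

end
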